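import Summits.HubbardSuperconductivity.HubbardSuperconductivity.Theses.ThermalWedge
import Summits.HubbardSuperconductivity.HubbardSuperconductivity.Theorems.ThermalWedgeTwSourcedInertnessLadder
import Summits.HubbardSuperconductivity.HubbardSuperconductivity.Theorems.ThermalWedgeTwSourcedCondensationFreeLinearCooperLog
import Summits.HubbardSuperconductivity.HubbardSuperconductivity.Theorems.ThermalWedgeTwSourcedCondensationFreeLinearThermalLaw
import Summits.HubbardSuperconductivity.HubbardSuperconductivity.Theorems.ThermalWedgeTwSourcedCondensationShallowWindow
import Summits.HubbardSuperconductivity.HubbardSuperconductivity.Theorems.TwSourcedCondensation.Negative.NormalFormsAndFrozenThreshold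
import Literature.MathematicalPhysics.QuantumLattice.GibbsPressureTemperature
import Literature.MathematicalPhysics.QuantumLattice.DWaveSourceProofs

/-!
# Route `ThermalWedge`, crux `TwSourcedCondensation` (item `stmt-HubbardSuperconductivity-1697`):
# the entropy-staircase skeleton (line `entropy-staircase-linear-regime`), v4 — shallow ∨ deep

The crux asks, for every compact `[μ₁,μ₂] ⊂ (-4,0)`, constants `U₀ a c C h₀ > 0` such that for
`0 < U ≤ U₀`, `1 ≤ β ≤ e^{a/U}`, `μ ∈ [μ₁,μ₂]`, eventually in `L`, for `|h| ≤ h₀`: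
`c h² log(1/(|h|+1/β)) − C h² ≤ p̃_L(β,U,μ,h) − p̃_L(β,U,μ,0)`,
`p̃_L(β,U,μ,h) = log Re Z_β(dWaveSourceTorus L U μ h)/(βL²)` (the sourced torus pressure).

LINE (entropy staircase / thermal ratchet), v4. Two chords of the convex, decreasing map
`β ↦ β⁻¹ log Z_β` give the exact finite-volume RATCHET
`[p̃(β₁,h) − p̃(β₁,0)] − [p̃(β₁/2,h) − p̃(β₁,h)] ≤ p̃(β,h) − p̃(β,0)` for `0 < β₁ ≤ β`
(`thermalRatchet_div_le`, Literature p80167; torus form `thermalRatchet_dWaveSource'`), so the crux only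
needs the LINEAR regime `|h| ≤ 1/β` (at `β` itself, or at the dyadic rung `β₁ = β/2^k` with
`β₁|h| ≤ 1 < 2β₁|h|`, `tw_aux_minimal_rung`). v4 splits the source window in two:
* SHALLOW `U ≤ h²` — NO interacting input: the crude slacks `|p̃_U − p̃_0| ≤ |U| ≤ h²` replace the
  constructive stubs; this is the registered stub `twSourcedCondensation_shallowWindow`, PROVED
  (`Theorems/ThermalWedgeTwSourcedCondensationShallowWindow.lean`: the crux with the FREE constant `c₀`,
  all `β ≥ 1`, every real `U`);
* DEEP `h² < U` — the constructive residual, now confined to where it is irreducible: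
  (S') `stub_deepSourceSlack`: `∀ η ∃ U₀ a K β₀`: interaction slack of the sourced gain `≥ −(η log β + K)h²`
       on `|h| ≤ 1/β`, `h² < U`, `β₀ ≤ β ≤ e^{a/U}` (one-cutoff sourced expansion, difference form; the warm
       rungs `β < β₀` are in the crux's trivial zone `c log β₀ ≤ C`, so `β₀` is the stub's to choose);
  (T') `stub_deepThermalSlack`: `∀ η ∃ U₀ a K'`: interaction slack of the dyadic heat chord
       `≤ (η log β + K')/β²` on the THERMAL DIAGONAL `1/(2β) < |h| ≤ 1/β` with `h² < U` (so automatically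
       `β > 1/(2√U₀)`: cold), `1 ≤ β ≤ e^{a/U}`.
  The free inputs (F) `stub_freeLinearCooperLog` (p77664) and (Fh) `stub_freeLinearThermalLaw` (p78799) are
  landed. Composition: constants `c = min(c₀/2, c_sh)`, `h₀ = min(1/4, h_sh)`,
  `C = C_sh + C₀ + K + 4C₁ + 4K' + c₀ + c₀ log β₀`, `U₀ = min`, `a = min`; `L₀` = max of the shallow
  threshold and the finite maximum of the four deep thresholds over the ladder `β/2^j`, `j ≤ ⌈β⌉₊`
  (the crux's quantifier order `∃ L₀` after `β, μ`, before `h`, is respected); where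
  `log(1/(|h|+1/β)) ≤ 0` the claim is the response's non-negativity (`pressure_response_nonneg`).

Disproof honoured (`Cruxes/TwSourcedCondensation/Disproof.lean` gen 3, `Theorems/…/Negative/*`): `log β`
floors only on `|h| ≤ 1/β` (§4c), `L₀` grows with `β` (§4a, §7, §8), both `|h|` and `1/β` inside the log
(§6a), order `h²` (§6b); §9 TARGETS: (S),(T) survive — v4 only SHRINKS them (extra hypotheses
`h² < U`, `β₀ ≤ β`, diagonal), so every disproof fact about (S),(T) applies verbatim to (S'),(T').

Sources: Ruelle, *Statistical Mechanics* (1969) §2.5–2.6 (thermodynamic convexity in `β`); M. Salmhofer,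
*Renormalization* (1999) §4.5.4; the tree's `GibbsPressureTemperature`, the two free stub files, the
shallow-window file.
-/

noncomputable section

namespace Summit.HubbardSuperconductivity.HubbardSuperconductivity.Theorems

open Matrix Finset Literature.MathematicalPhysics.QuantumLattice
open Summit.HubbardSuperconductivity.HubbardSuperconductivity.Theses.ThermalWedge

/-! ### The stubs (registered; `sorry` only here) -/

-- Stub (F) `stub_freeLinearCooperLog` LANDED: Theorems/ThermalWedgeTwSourcedCondensationFreeLinearCooperLog.lean (p77664).

-- Stub (Fh) `stub_freeLinearThermalLaw` LANDED: Theorems/ThermalWedgeTwSourcedCondensationFreeLinearThermalLaw.lean (p78799).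

-- Stub (Sh) `twSourcedCondensation_shallowWindow` LANDED: Theorems/ThermalWedgeTwSourcedCondensationShallowWindow.lean (p96342).

/-- **Stub (S'): deep source slack (LOAD-BEARING, constructive).** `∀ η > 0 ∃ U₀ a K β₀`: for
`0 < U ≤ U₀`, `β₀ ≤ β ≤ e^{a/U}`, on the window `|h| ≤ 1/β` intersected with the deep window `h² < U`,
eventually in `L`:
`[p̃₀(β,h) − p̃₀(β,0)] − (η log β + K)h² ≤ p̃_U(β,h) − p̃_U(β,0)` — the interaction does not destroy the
free Cooper logarithm in the one-cutoff regime (relative corrections `O(U log β) = O(a)`). The shallow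
window `U ≤ h²` and the warm temperatures `β < β₀` are NOT asked (settled resp. trivial at crux level). -/
theorem stub_deepSourceSlack :
    ∀ μ₁ μ₂ : ℝ, -4 < μ₁ → μ₁ ≤ μ₂ → μ₂ < 0 → ∀ η : ℝ, 0 < η → ∃ U₀ a K β₀ : ℝ, 0 < U₀ ∧ 0 < a ∧
      0 < K ∧ 1 ≤ β₀ ∧ ∀ U : ℝ, 0 < U → U ≤ U₀ → ∀ β : ℝ, β₀ ≤ β → β ≤ Real.exp (a / U) →
      ∀ μ ∈ Set.Icc μ₁ μ₂, ∃ L₀ : ℕ, ∀ (L : ℕ) [NeZero L], L₀ ≤ L → ∀ h : ℝ, |h| ≤ 1 / β →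
      h ^ 2 < U → (Real.log (Matrix.partitionFn β
      (Literature.MathematicalPhysics.QuantumLattice.dWaveSourceTorus L 0 μ h)).re / (β * (L : ℝ) ^ 2)
      - Real.log (Matrix.partitionFn β (Literature.MathematicalPhysics.QuantumLattice.dWaveSourceTorus
      L 0 μ 0)).re / (β * (L : ℝ) ^ 2)) - (η * Real.log β + K) * h ^ 2 ≤ Real.log (Matrix.partitionFn
      β (Literature.MathematicalPhysics.QuantumLattice.dWaveSourceTorus L U μ h)).re / (β * (L : ℝ) ^
      2) - Real.log (Matrix.partitionFn β
      (Literature.MathematicalPhysics.QuantumLattice.dWaveSourceTorus L U μ 0)).re / (β * (L : ℝ) ^ 2) := by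
  sorry

/-- **Stub (T'): deep diagonal thermal slack (constructive).** `∀ η > 0 ∃ U₀ a K'`: for `0 < U ≤ U₀`,
`1 ≤ β ≤ e^{a/U}`, on the thermal DIAGONAL `1/(2β) < |h| ≤ 1/β` intersected with the deep window
`h² < U` (hence `β > 1/(2√U₀)`), eventually in `L`: the interaction correction to the dyadic heat chord
is `≤ (η log β + K')/β²` (interacting specific heat of Fermi-liquid size at `T ≥ e^{-a/U}`). -/
theorem stub_deepThermalSlack :
    ∀ μ₁ μ₂ : ℝ, -4 < μ₁ → μ₁ ≤ μ₂ → μ₂ < 0 → ∀ η : ℝ, 0 < η → ∃ U₀ a K' : ℝ, 0 < U₀ ∧ 0 < a ∧ 0 <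
      K' ∧ ∀ U : ℝ, 0 < U → U ≤ U₀ → ∀ β : ℝ, 1 ≤ β → β ≤ Real.exp (a / U) → ∀ μ ∈ Set.Icc μ₁ μ₂, ∃ L₀
      : ℕ, ∀ (L : ℕ) [NeZero L], L₀ ≤ L → ∀ h : ℝ, |h| ≤ 1 / β → 1 < |h| * (2 * β) → h ^ 2 < U →
      (Real.log (Matrix.partitionFn (β / 2)
      (Literature.MathematicalPhysics.QuantumLattice.dWaveSourceTorus L U μ h)).re / (β / 2 * (L : ℝ)
      ^ 2) - Real.log (Matrix.partitionFn β
      (Literature.MathematicalPhysics.QuantumLattice.dWaveSourceTorus L U μ h)).re / (β * (L : ℝ) ^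
      2)) - (Real.log (Matrix.partitionFn (β / 2)
      (Literature.MathematicalPhysics.QuantumLattice.dWaveSourceTorus L 0 μ h)).re / (β / 2 * (L : ℝ)
      ^ 2) - Real.log (Matrix.partitionFn β
      (Literature.MathematicalPhysics.QuantumLattice.dWaveSourceTorus L 0 μ h)).re / (β * (L : ℝ) ^
      2)) ≤ (η * Real.log β + K') / β ^ 2 := by
  sorry

/-! ### The composition -/

/-- Monotonicity of the ceiling: `β ≤ e^{a/U}` and `a ≤ a'`, `U > 0` give `β ≤ e^{a'/U}`. [folklore] -/
theorem le_exp_div_of_le' {β a a' U : ℝ} (hU : 0 < U) (h : β ≤ Real.exp (a / U)) (haa : a ≤ a') :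
    β ≤ Real.exp (a' / U) :=
  h.trans (Real.exp_le_exp.2 (div_le_div_of_nonneg_right haa hU.le))

/-- **The entropy staircase, v4: the crux from the line's stubs** (F) + (Fh) + (Sh) [landed] + (S') + (T')
⇒ `TwSourcedCondensation` (sorries live only in `stub_deepSourceSlack` / `stub_deepThermalSlack`; the
composition is a real proof). -/
theorem TwSourcedCondensation_of : TwSourcedCondensation := by
  have hF := stub_freeLinearCooperLog
  have hFh := stub_freeLinearThermalLaw
  have hSh := twSourcedCondensation_shallowWindow
  have hS := stub_deepSourceSlack
  have hT := stub_deepThermalSlack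
  classical
  intro μ₁ μ₂ h4 h12 h0
  obtain ⟨c₀, C₀, hc₀, hC₀, hF⟩ := hF μ₁ μ₂ h4 h12 h0
  obtain ⟨C₁, hC₁, hFh⟩ := hFh μ₁ μ₂ h4 h12 h0
  obtain ⟨cs, Cs, hs, hcs, hCs, hhs, hSh⟩ := hSh μ₁ μ₂ h4 h12 h0
  obtain ⟨U₁, a₁, K, β₀, hU₁, ha₁, hK, hβ₀, hS⟩ := hS μ₁ μ₂ h4 h12 h0 (c₀ / 4) (by positivity)
  obtain ⟨U₂, a₂, K', hU₂, ha₂, hK', hT⟩ := hT μ₁ μ₂ h4 h12 h0 (c₀ / 16) (by positivity)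
  have hlogβ₀ : 0 ≤ Real.log β₀ := Real.log_nonneg hβ₀
  refine ⟨min U₁ U₂, min a₁ a₂, min (c₀ / 2) cs,
    Cs + (C₀ + K + 4 * C₁ + 4 * K' + c₀ + c₀ * Real.log β₀), min (1 / 4) hs,
    lt_min hU₁ hU₂, lt_min ha₁ ha₂, lt_min (by positivity) hcs, by positivity,
    lt_min (by norm_num) hhs, ?_⟩
  intro U hU hUU₀ β hβ hβa μ hμ
  have hβpos : 0 < β := by linarith only [hβ]
  have hUU₁ : U ≤ U₁ := hUU₀.trans (min_le_left _ _)
  have hUU₂ : U ≤ U₂ := hUU₀.trans (min_le_right _ _)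
  have hβa₁ : β ≤ Real.exp (a₁ / U) := le_exp_div_of_le' hU hβa (min_le_left _ _)
  have hβa₂ : β ≤ Real.exp (a₂ / U) := le_exp_div_of_le' hU hβa (min_le_right _ _)
  -- total versions of the four `eventually in L` deep hypotheses (at this `U, μ`), then choice functions
  have hF' : ∀ β' : ℝ, ∃ L₀ : ℕ, 1 ≤ β' → ∀ (L : ℕ) [NeZero L], L₀ ≤ L → ∀ h : ℝ, |h| ≤ 1 / β' →
      c₀ * h ^ 2 * Real.log β' - C₀ * h ^ 2 ≤
        Real.log (partitionFn β' (dWaveSourceTorus L 0 μ h)).re / (β' * (L : ℝ) ^ 2) -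
          Real.log (partitionFn β' (dWaveSourceTorus L 0 μ 0)).re / (β' * (L : ℝ) ^ 2) := by
    intro β'
    by_cases hb : 1 ≤ β'
    · obtain ⟨L₀, hL₀⟩ := hF β' hb μ hμ
      exact ⟨L₀, fun _ => hL₀⟩
    · exact ⟨0, fun h1 => (hb h1).elim⟩
  have hFh' : ∀ β' : ℝ, ∃ L₀ : ℕ, 1 ≤ β' → ∀ (L : ℕ) [NeZero L], L₀ ≤ L → ∀ h : ℝ, |h| ≤ 1 / β' →
      Real.log (partitionFn (β' / 2) (dWaveSourceTorus L 0 μ h)).re / (β' / 2 * (L : ℝ) ^ 2) -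
          Real.log (partitionFn β' (dWaveSourceTorus L 0 μ h)).re / (β' * (L : ℝ) ^ 2) ≤
        C₁ / β' ^ 2 := by
    intro β'
    by_cases hb : 1 ≤ β'
    · obtain ⟨L₀, hL₀⟩ := hFh β' hb μ hμ
      exact ⟨L₀, fun _ => hL₀⟩
    · exact ⟨0, fun h1 => (hb h1).elim⟩
  have hS' : ∀ β' : ℝ, ∃ L₀ : ℕ, β₀ ≤ β' → β' ≤ Real.exp (a₁ / U) → ∀ (L : ℕ) [NeZero L], L₀ ≤ L →
      ∀ h : ℝ, |h| ≤ 1 / β' → h ^ 2 < U →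
      (Real.log (partitionFn β' (dWaveSourceTorus L 0 μ h)).re / (β' * (L : ℝ) ^ 2) -
          Real.log (partitionFn β' (dWaveSourceTorus L 0 μ 0)).re / (β' * (L : ℝ) ^ 2)) -
        (c₀ / 4 * Real.log β' + K) * h ^ 2 ≤
      Real.log (partitionFn β' (dWaveSourceTorus L U μ h)).re / (β' * (L : ℝ) ^ 2) -
        Real.log (partitionFn β' (dWaveSourceTorus L U μ 0)).re / (β' * (L : ℝ) ^ 2) := by
    intro β'
    by_cases hb : β₀ ≤ β' ∧ β' ≤ Real.exp (a₁ / U)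
    · obtain ⟨L₀, hL₀⟩ := hS U hU hUU₁ β' hb.1 hb.2 μ hμ
      exact ⟨L₀, fun _ _ => hL₀⟩
    · exact ⟨0, fun h1 h2 => (hb ⟨h1, h2⟩).elim⟩
  have hT' : ∀ β' : ℝ, ∃ L₀ : ℕ, 1 ≤ β' → β' ≤ Real.exp (a₂ / U) → ∀ (L : ℕ) [NeZero L], L₀ ≤ L →
      ∀ h : ℝ, |h| ≤ 1 / β' → 1 < |h| * (2 * β') → h ^ 2 < U →
      (Real.log (partitionFn (β' / 2) (dWaveSourceTorus L U μ h)).re / (β' / 2 * (L : ℝ) ^ 2) -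
          Real.log (partitionFn β' (dWaveSourceTorus L U μ h)).re / (β' * (L : ℝ) ^ 2)) -
        (Real.log (partitionFn (β' / 2) (dWaveSourceTorus L 0 μ h)).re / (β' / 2 * (L : ℝ) ^ 2) -
          Real.log (partitionFn β' (dWaveSourceTorus L 0 μ h)).re / (β' * (L : ℝ) ^ 2)) ≤
      (c₀ / 16 * Real.log β' + K') / β' ^ 2 := by
    intro β'
    by_cases hb : 1 ≤ β' ∧ β' ≤ Real.exp (a₂ / U)
    · obtain ⟨L₀, hL₀⟩ := hT U hU hUU₂ β' hb.1 hb.2 μ hμ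
      exact ⟨L₀, fun _ _ => hL₀⟩
    · exact ⟨0, fun h1 h2 => (hb ⟨h1, h2⟩).elim⟩
  choose fF hfF using hF'
  choose fFh hfFh using hFh'
  choose fS hfS using hS'
  choose fT hfT using hT'
  obtain ⟨Lsh, hLsh⟩ := hSh β hβ μ hμ
  -- L₀: the shallow threshold and the largest deep threshold over the dyadic ladder β / 2^j, j ≤ ⌈β⌉₊
  refine ⟨max Lsh ((Finset.range (⌈β⌉₊ + 1)).sup fun j =>
    max (max (fF (β / 2 ^ j)) (fFh (β / 2 ^ j))) (max (fS (β / 2 ^ j)) (fT (β / 2 ^ j)))), ?_⟩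
  intro L _ hL h hh
  have hLshL : Lsh ≤ L := (le_max_left _ _).trans hL
  have hLsup := (le_max_right _ _).trans hL
  have hLj : ∀ j, j ≤ ⌈β⌉₊ → fF (β / 2 ^ j) ≤ L ∧ fFh (β / 2 ^ j) ≤ L ∧
      fS (β / 2 ^ j) ≤ L ∧ fT (β / 2 ^ j) ≤ L := by
    intro j hj
    have hmem : j ∈ Finset.range (⌈β⌉₊ + 1) := Finset.mem_range.mpr (Nat.lt_succ_of_le hj)
    have hsup := (Finset.le_sup (f := fun j =>
      max (max (fF (β / 2 ^ j)) (fFh (β / 2 ^ j))) (max (fS (β / 2 ^ j)) (fT (β / 2 ^ j)))) hmem).trans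
      hLsup
    exact ⟨((le_max_left _ _).trans (le_max_left _ _)).trans hsup,
      ((le_max_right _ _).trans (le_max_left _ _)).trans hsup,
      ((le_max_left _ _).trans (le_max_right _ _)).trans hsup,
      ((le_max_right _ _).trans (le_max_right _ _)).trans hsup⟩
  have hsq : 0 ≤ h ^ 2 := sq_nonneg h
  have hh4 : |h| ≤ 1 / 4 := hh.trans (min_le_left _ _)
  have hhs' : |h| ≤ hs := hh.trans (min_le_right _ _)
  -- notation for the pressures
  set P : ℝ → ℝ → ℝ → ℝ := fun b u s =>
    Real.log (partitionFn b (dWaveSourceTorus L u μ s)).re / (b * (L : ℝ) ^ 2) with hPdef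
  set ℓ : ℝ := Real.log (1 / (|h| + 1 / β)) with hℓdef
  have hresp : 0 ≤ P β U h - P β U 0 := TwSourcedCondensation.Negative.pressure_response_nonneg L hβpos.le U μ h
  -- where the cutoff logarithm is non-positive, the claim is the response's non-negativity
  rcases le_or_gt ℓ 0 with hℓ0 | hℓpos
  · change min (c₀ / 2) cs * h ^ 2 * ℓ - (Cs + (C₀ + K + 4 * C₁ + 4 * K' + c₀ + c₀ * Real.log β₀)) * h ^ 2
      ≤ P β U h - P β U 0
    have h1 : min (c₀ / 2) cs * h ^ 2 * ℓ ≤ 0 :=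
      mul_nonpos_of_nonneg_of_nonpos (by positivity) hℓ0
    have h2 : 0 ≤ (Cs + (C₀ + K + 4 * C₁ + 4 * K' + c₀ + c₀ * Real.log β₀)) * h ^ 2 := by positivity
    linarith only [h1, h2, hresp]
  -- monotonicity of the floor in `c` (now `ℓ > 0`)
  have hmono : ∀ c' : ℝ, min (c₀ / 2) cs ≤ c' → min (c₀ / 2) cs * h ^ 2 * ℓ ≤ c' * h ^ 2 * ℓ :=
    fun c' hc' => mul_le_mul_of_nonneg_right (mul_le_mul_of_nonneg_right hc' hsq) hℓpos.le
  rcases le_or_gt U (h ^ 2) with hshallow | hdeep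
  · -- SHALLOW window `U ≤ h²`: the landed stub, no interacting input
    have hUh : |U| ≤ h ^ 2 := by rwa [abs_of_pos hU]
    have h1 := hLsh L hLshL U h hhs' hUh
    change cs * h ^ 2 * ℓ - Cs * h ^ 2 ≤ P β U h - P β U 0 at h1
    change min (c₀ / 2) cs * h ^ 2 * ℓ - (Cs + (C₀ + K + 4 * C₁ + 4 * K' + c₀ + c₀ * Real.log β₀)) * h ^ 2
      ≤ P β U h - P β U 0
    have h2 := hmono cs (min_le_right _ _)
    have h3 : 0 ≤ (C₀ + K + 4 * C₁ + 4 * K' + c₀ + c₀ * Real.log β₀) * h ^ 2 := by positivity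
    linarith only [h1, h2, h3]
  -- DEEP window `h² < U`
  have hc2 := hmono (c₀ / 2) (min_le_left _ _)
  change min (c₀ / 2) cs * h ^ 2 * ℓ - (Cs + (C₀ + K + 4 * C₁ + 4 * K' + c₀ + c₀ * Real.log β₀)) * h ^ 2
    ≤ P β U h - P β U 0
  have hCs2 : 0 ≤ Cs * h ^ 2 := by positivity
  rcases le_or_gt (|h| * β) 1 with hlin | hout
  · -- Case A: inside the window at β itself (rung j = 0)
    have hwin : |h| ≤ 1 / β := by
      rw [le_div_iff₀ hβpos]
      exact hlin
    have hlogβ : 0 ≤ Real.log β := Real.log_nonneg hβ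
    have hcut : ℓ ≤ Real.log β := TwSourcedCondensation.Negative.log_cutoff_le_log hβpos h
    have h3 : c₀ / 2 * h ^ 2 * ℓ ≤ c₀ / 2 * h ^ 2 * Real.log β :=
      mul_le_mul_of_nonneg_left hcut (by positivity)
    rcases lt_or_ge β β₀ with hwarm | hcold
    · -- warm: trivial zone `log β < log β₀`
      have h4 : Real.log β ≤ Real.log β₀ := Real.log_le_log hβpos hwarm.le
      have h5 : c₀ / 2 * h ^ 2 * Real.log β ≤ c₀ / 2 * h ^ 2 * Real.log β₀ :=
        mul_le_mul_of_nonneg_left h4 (by positivity)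
      have h6 : 0 ≤ (C₀ + K + 4 * C₁ + 4 * K' + c₀) * h ^ 2 := by positivity
      have h7 : 0 ≤ c₀ / 2 * h ^ 2 * Real.log β₀ := by positivity
      linarith only [hresp, hc2, h3, h5, h6, h7, hCs2]
    have h0' := hLj 0 (Nat.zero_le _)
    simp only [pow_zero, div_one] at h0'
    have h1 := hfF β hβ L h0'.1 h hwin
    have h2 := hfS β hcold hβa₁ L h0'.2.2.1 h hwin hdeep
    change c₀ * h ^ 2 * Real.log β - C₀ * h ^ 2 ≤ P β 0 h - P β 0 0 at h1
    change (P β 0 h - P β 0 0) - (c₀ / 4 * Real.log β + K) * h ^ 2 ≤ P β U h - P β U 0 at h2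
    have h5 : 0 ≤ (4 * C₁ + 4 * K' + c₀ + c₀ * Real.log β₀) * h ^ 2 := by positivity
    have h6 : 0 ≤ c₀ * (h ^ 2 * Real.log β) := by positivity
    linarith only [h1, h2, h3, h5, h6, hc2, hCs2]
  · -- Case B: climb the dyadic ladder to the thermal window
    have hsmall : |h| < 1 / 2 := by linarith only [hh4]
    obtain ⟨k, hkK, hkspec, hone, -, hprev⟩ := tw_aux_minimal_rung one_pos hβ hsmall
    have hkpos : 0 < k := by
      rcases Nat.eq_zero_or_pos k with hk0 | hkp
      · exfalso
        rw [hk0, pow_zero, div_one] at hkspec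
        linarith only [hkspec, hout]
      · exact hkp
    have hprev' : 1 < |h| * (2 * (β / 2 ^ k)) := hprev hkpos
    set β₁ : ℝ := β / 2 ^ k with hβ₁def
    have hβ₁pos : 0 < β₁ := by positivity
    have hβ₁le : β₁ ≤ β := div_le_self hβpos.le (one_le_pow₀ (by norm_num))
    have hwin : |h| ≤ 1 / β₁ := by
      rw [le_div_iff₀ hβ₁pos]
      exact hkspec
    have hlogβ₁ : 0 ≤ Real.log β₁ := Real.log_nonneg hone
    have hcut : ℓ ≤ Real.log β₁ + 1 := log_cutoff_le_log_rung' hβpos hβ₁pos hprev'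
    have h10 : c₀ / 2 * h ^ 2 * ℓ ≤ c₀ / 2 * h ^ 2 * (Real.log β₁ + 1) :=
      mul_le_mul_of_nonneg_left hcut (by positivity)
    rcases lt_or_ge β₁ β₀ with hwarm | hcold
    · -- warm rung: trivial zone `log β₁ + 1 ≤ log β₀ + 1`
      have h4 : Real.log β₁ ≤ Real.log β₀ := Real.log_le_log hβ₁pos hwarm.le
      have h5 : c₀ / 2 * h ^ 2 * (Real.log β₁ + 1) ≤ c₀ / 2 * h ^ 2 * (Real.log β₀ + 1) :=
        mul_le_mul_of_nonneg_left (by linarith only [h4]) (by positivity)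
      have h6 : 0 ≤ (C₀ + K + 4 * C₁ + 4 * K') * h ^ 2 := by positivity
      have h7 : 0 ≤ c₀ / 2 * h ^ 2 * (Real.log β₀ + 1) := by positivity
      linarith only [hresp, hc2, h10, h5, h6, h7, hCs2]
    have hLk := hLj k hkK
    have h1 := hfF β₁ hone L hLk.1 h hwin
    have h2 := hfFh β₁ hone L hLk.2.1 h hwin
    have h3 := hfS β₁ hcold (hβ₁le.trans hβa₁) L hLk.2.2.1 h hwin hdeep
    have h5 := hfT β₁ hone (hβ₁le.trans hβa₂) L hLk.2.2.2 h hwin hprev' hdeep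
    have hrat := thermalRatchet_dWaveSource' L U μ h hβ₁pos hβ₁le
    -- 1/β₁² ≤ 4 h²
    have hinv : 1 / β₁ ^ 2 ≤ 4 * h ^ 2 := by
      rw [div_le_iff₀ (by positivity)]
      have h6 : 1 < (|h| * (2 * β₁)) ^ 2 := one_lt_pow₀ hprev' two_ne_zero
      calc (1 : ℝ) ≤ (|h| * (2 * β₁)) ^ 2 := h6.le
        _ = 4 * h ^ 2 * β₁ ^ 2 := by rw [mul_pow, mul_pow, sq_abs]; ring
    change c₀ * h ^ 2 * Real.log β₁ - C₀ * h ^ 2 ≤ P β₁ 0 h - P β₁ 0 0 at h1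
    change P (β₁ / 2) 0 h - P β₁ 0 h ≤ C₁ / β₁ ^ 2 at h2
    change (P β₁ 0 h - P β₁ 0 0) - (c₀ / 4 * Real.log β₁ + K) * h ^ 2 ≤ P β₁ U h - P β₁ U 0 at h3
    change (P (β₁ / 2) U h - P β₁ U h) - (P (β₁ / 2) 0 h - P β₁ 0 h) ≤
      (c₀ / 16 * Real.log β₁ + K') / β₁ ^ 2 at h5
    change (P β₁ U h - P β₁ U 0) - (P (β₁ / 2) U h - P β₁ U h) ≤ P β U h - P β U 0 at hrat
    -- the heat chord at β₁ in terms of h²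
    have hchord : P (β₁ / 2) U h - P β₁ U h ≤
        4 * (C₁ + K') * h ^ 2 + c₀ / 4 * h ^ 2 * Real.log β₁ := by
      have e1 : C₁ / β₁ ^ 2 = C₁ * (1 / β₁ ^ 2) := by ring
      have e2 : (c₀ / 16 * Real.log β₁ + K') / β₁ ^ 2 =
          (c₀ / 16 * Real.log β₁ + K') * (1 / β₁ ^ 2) := by ring
      have h8 : C₁ * (1 / β₁ ^ 2) ≤ C₁ * (4 * h ^ 2) := mul_le_mul_of_nonneg_left hinv hC₁.le
      have h9 : (c₀ / 16 * Real.log β₁ + K') * (1 / β₁ ^ 2) ≤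
          (c₀ / 16 * Real.log β₁ + K') * (4 * h ^ 2) :=
        mul_le_mul_of_nonneg_left hinv (by positivity)
      rw [e1] at h2
      rw [e2] at h5
      linarith only [h2, h5, h8, h9]
    have h11 : 0 ≤ c₀ * h ^ 2 := by positivity
    have h12 : 0 ≤ c₀ * Real.log β₀ * h ^ 2 := by positivity
    linarith only [h1, h3, hrat, hchord, h10, h11, h12, hc2, hCs2]

end Summit.HubbardSuperconductivity.HubbardSuperconductivity.Theorems
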